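import Summits.ResolutionOfSingularities.ResolutionOfSingularities.Theorems.FrobeniusClosingPatchingRelPerfectTwoPlanesPlaneJq
import HarnessLib

/-!
# Crux `PatchingRelPerfect` (stmt-ResolutionOfSingularities-16161), chain w52 — the rank-two member
# `f = x₀x₁ + x₂³`: the plane step with an exceptional twist of ANY multiplicity

[OURS · L1 W5.2 · rung, assembly tool] `…TwoPlanesPlaneJq` treats the shape
`(u)ᵃ · ((J_i · (u,e₀)) · (u,e₀))` produced by the point avatar `J_q`.  The second repair of the
companion (design note NEXT-two-planes-cube.md, Addendum 12: the PLANE avatar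
`J_π = (x₀, x₁x₃, x₂x₃)² + (x₀x₁², x₀x₂², x₁⁴, x₂⁴, x₃⁵)`, whose image on `B₁`, `B₂` is
`u² (u, e₀)²`, kit j288133) needs the same step with `(u, e₀)^m` for `m = 3`.  PROVED, for every `m`:

* `map_mul_pow_plane_chart` — `(J · (u,e₀)^m) ↦ (w_k^m) · J` on each chart of `Bl_{(u,e₀)}`;
* `tpPlane_chartPow_zero`, `tpPlane_chartPow_succ` — the two charts after the twist (Stacks 080B);
* `isRegular_of_isBlowup_tpPlane_corePow` — every blowing up of `Spec B_i` along
  `(u)ᵃ · ((J_i · (u,e₀)^m) · (u,e₀))` is regular, under the chart-coordinate hypotheses of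
  `…TwoPlanesPlane`; `…_corePow_two_three` (`i = 2, 3` modulo `hQr hQ0`), `…_corePow_two`
  (`B₂`, unconditional).

Nothing here is a statement of the manuscript under review.

## References

* The Stacks Project, Tags 080A, 080B. [StacksProject]
-/

-- `Summit.<Summit>.<Sub>.Theorems` with `Sub = Summit` (single-conjunct summit, D-0017)
set_option linter.dupNamespace false

noncomputable section

open CategoryTheory CategoryTheory.Limits AlgebraicGeometry Literature.AlgebraicGeometry.Resolution
open IsLocalRing

namespace Summit.ResolutionOfSingularities.ResolutionOfSingularities.Theorems

namespace TwoPlanesRung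

open ConeRung

universe u

section PlanePow

variable {S : Type u} [CommRing S] [IsRegularLocalRing S] (x : Fin 4 → S)
  (hx : Ideal.span (Set.range x) = IsLocalRing.maximalIdeal S)
  (hd : (IsLocalRing.maximalIdeal S).spanFinrank = 4) (i : Fin 4)

local notation3 "M" => Ideal.span (Set.range x)
local notation3 "B" => chartRing x i
local notation3 "uB" => chartBase x i (x i)
local notation3 "e[" j "]" => chartGen x i j
local notation3 "U" => Ideal.span {chartBase x i (x i)}
/-- the plane centre `(u, e₀)` as a chart family and its ideal -/
local notation3 (prettyPrint := false) "cc" => (Fin.cons (chartBase x i (x i)) (fun _ : Fin 1 => chartGen x i 0) : Fin 2 → chartRing x i)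
local notation3 (prettyPrint := false) "II" => Ideal.span (Set.range
  (Fin.cons (chartBase x i (x i)) (fun _ : Fin 1 => chartGen x i 0) : Fin 2 → chartRing x i))
/-- the three later companion factors on `B_i` (divided by `u²` each) -/
local notation3 (prettyPrint := false) "J" => Ideal.span {chartGen x i 0 * chartGen x i 1, chartBase x i (x i)} *
    (Ideal.span {chartGen x i 0 * chartGen x i 1 + chartBase x i (x i) * chartGen x i 2 ^ 3} ⊔
      Ideal.span {chartBase x i (x i)} * Ideal.span {chartGen x i 0} ⊔ Ideal.span {chartBase x i (x i)} ^ 2) *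
    (Ideal.span {chartGen x i 0 * chartGen x i 1 + chartBase x i (x i) * chartGen x i 2 ^ 3} ⊔
      Ideal.span {chartBase x i (x i)} ^ 2)
/-- the exceptional-curve models of the two level-two charts -/
local notation3 (prettyPrint := false) "PP" => MvPolynomial {j : Fin 2 // j ≠ Fin.succ 0} (chartRing x i ⧸ II)
local notation3 (prettyPrint := false) "gFlat" => (MvPolynomial.C (Ideal.Quotient.mk II (chartGen x i 1)) :
    MvPolynomial {j : Fin 2 // j ≠ Fin.succ 0} (chartRing x i ⧸ II))
  + MvPolynomial.X (⟨0, (Fin.succ_ne_zero 0).symm⟩ : {j : Fin 2 // j ≠ Fin.succ 0}) *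
    MvPolynomial.C (Ideal.Quotient.mk II (chartGen x i 2 ^ 3))
local notation3 (prettyPrint := false) "XFlat" => (MvPolynomial.X (⟨0, (Fin.succ_ne_zero 0).symm⟩ : {j : Fin 2 // j ≠ Fin.succ 0}) :
  MvPolynomial {j : Fin 2 // j ≠ Fin.succ 0} (chartRing x i ⧸ II))
local notation3 (prettyPrint := false) "PP₀" => MvPolynomial {j : Fin 2 // j ≠ 0} (chartRing x i ⧸ II)
local notation3 (prettyPrint := false) "hFlat" => MvPolynomial.X (⟨1, one_ne_zero_fin2⟩ : {j : Fin 2 // j ≠ 0}) *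
    (MvPolynomial.C (Ideal.Quotient.mk II (chartGen x i 1)) : MvPolynomial {j : Fin 2 // j ≠ 0} (chartRing x i ⧸ II))
  + MvPolynomial.C (Ideal.Quotient.mk II (chartGen x i 2 ^ 3))

omit [IsRegularLocalRing S] in
/-- On each chart of `Bl_{(u,e₀)} Spec B_i`: `(J · (u,e₀)^m) ↦ (w_k^m) · J`.
[cite: StacksProject, Tag 0804] -/
theorem map_mul_pow_plane_chart (m : ℕ) (k : Fin 2) :
    (J * II ^ m).map (chartBase cc k) = Ideal.span {chartBase cc k (cc k) ^ m} * (J).map (chartBase cc k) := by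
  have h3 : (II).map (chartBase cc k) = Ideal.span {chartBase cc k (cc k)} :=
    map_span_range_plane_chart x i k
  have h2 : (II ^ m).map (chartBase cc k) = Ideal.span {chartBase cc k (cc k) ^ m} :=
    (Ideal.map_pow _ _ m).trans ((congrArg (fun T : Ideal (chartRing cc k) => T ^ m) h3).trans
      (Ideal.span_singleton_pow _ m))
  exact ((Ideal.map_mul (chartBase cc k) (J) (II ^ m)).trans
    (congrArg (fun T => (J).map (chartBase cc k) * T) h2)).trans (mul_comm _ _)

omit [IsRegularLocalRing S] in
/-- The `s`-chart of the plane blow-up, with the exceptional twist `(u,e₀)^m·𝒪 = (w₀^m)` removed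
first. [cite: StacksProject, Tag 080B] -/
theorem tpPlane_chartPow_zero (m : ℕ) (hc : IsQuasiRegular cc) (hB : IsDomain B) (hBr : IsRegularRing B)
    (hdII : IsDomain (B ⧸ II)) (hrII : IsRegularRing (B ⧸ II)) (hu0 : uB ≠ 0)
    (hQr : IsRegularRing (PP₀ ⧸ Ideal.span {hFlat})) (hQ0 : hFlat ≠ 0)
    {Y' : Scheme.{u}} {ρ' : Y' ⟶ Spec (.of (chartRing cc 0))}
    (h' : IsBlowup ρ' (affineBlowup.idealSheaf ((J * II ^ m).map (chartBase cc 0)))) :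
    Scheme.IsRegular Y' := by
  rw [map_mul_pow_plane_chart] at h'
  exact CoreRungTower.isRegular_of_isBlowup_span_singleton_mul
    (pow_mem (reesChartBase_mem_nonZeroDivisors (cc 0) (Ideal.mem_span_range_self (f := cc) (x := 0))) m)
    _ (fun Y'' ρ'' h'' => tpPlane_chart_zero x i hc hB hBr hdII hrII hu0 hQr hQ0 h'') h'

omit [IsRegularLocalRing S] in
/-- The `t`-chart of the plane blow-up, with the exceptional twist `(u,e₀)^m·𝒪 = (w₁^m)` removed
first. [cite: StacksProject, Tag 080B] -/
theorem tpPlane_chartPow_succ (m : ℕ) (hc : IsQuasiRegular cc) (hB : IsDomain B) (hBr : IsRegularRing B)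
    (hdII : IsDomain (B ⧸ II)) (hrII : IsRegularRing (B ⧸ II)) (hdu : IsDomain (B ⧸ U))
    (hdy1 : IsDomain (B ⧸ Ideal.span {e[1]})) (hdIIy : IsDomain (B ⧸ (II ⊔ Ideal.span {e[1]})))
    (hdy : IsDomain (B ⧸ Ideal.span {uB, e[1]})) (hry : IsRegularRing (B ⧸ Ideal.span {uB, e[1]}))
    (hy : e[1] ∉ II) (hey : e[0] ∉ Ideal.span {e[1]}) (he : e[0] ∉ U) (heuy : e[0] ∉ U ⊔ Ideal.span {e[1]})
    (hPd : IsDomain (PP ⧸ Ideal.span {gFlat})) (hPr : IsRegularRing (PP ⧸ Ideal.span {gFlat}))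
    (hPX : XFlat ∉ Ideal.span {gFlat})
    {Y' : Scheme.{u}} {ρ' : Y' ⟶ Spec (.of (chartRing cc (Fin.succ 0)))}
    (h' : IsBlowup ρ' (affineBlowup.idealSheaf ((J * II ^ m).map (chartBase cc (Fin.succ 0))))) :
    Scheme.IsRegular Y' := by
  rw [map_mul_pow_plane_chart] at h'
  exact CoreRungTower.isRegular_of_isBlowup_span_singleton_mul
    (pow_mem (reesChartBase_mem_nonZeroDivisors (cc (Fin.succ 0))
      (Ideal.mem_span_range_self (f := cc) (x := Fin.succ 0))) m) _
    (fun Y'' ρ'' h'' => tpPlane_chart_succ x i hc hB hBr hdII hrII hdu hdy1 hdIIy hdy hry hy hey he heuy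
      hPd hPr hPX h'') h'

set_option maxHeartbeats 400000 in
include hx hd in
/-- **The plane step with an exceptional twist of multiplicity `m` — core form**: every blowing up
of `Spec B_i` along `(u)ᵃ · ((J_i · (u,e₀)^m) · (u,e₀))` is regular, given the chart-coordinate
facts of `…TwoPlanesPlane`. [cite: StacksProject, Tag 080A] [cite: StacksProject, Tag 080B] -/
theorem isRegular_of_isBlowup_tpPlane_corePow (hi : i ≠ 0) (m a : ℕ)
    (hdII : IsDomain (B ⧸ II)) (hdy1 : IsDomain (B ⧸ Ideal.span {e[1]}))
    (hdIIy : IsDomain (B ⧸ (II ⊔ Ideal.span {e[1]})))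
    (hdy : IsDomain (B ⧸ Ideal.span {uB, e[1]})) (hry : IsRegularRing (B ⧸ Ideal.span {uB, e[1]}))
    (hy : e[1] ∉ II) (hey : e[0] ∉ Ideal.span {e[1]}) (heuy : e[0] ∉ U ⊔ Ideal.span {e[1]})
    (hPd : IsDomain (PP ⧸ Ideal.span {gFlat})) (hPr : IsRegularRing (PP ⧸ Ideal.span {gFlat}))
    (hPX : XFlat ∉ Ideal.span {gFlat})
    (hQr : IsRegularRing (PP₀ ⧸ Ideal.span {hFlat})) (hQ0 : hFlat ≠ 0)
    {Y : Scheme.{u}} {ρ : Y ⟶ Spec (.of B)}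
    (hρ : IsBlowup ρ (affineBlowup.idealSheaf (Ideal.span {uB ^ a} * ((J * II ^ m) * II)))) :
    Scheme.IsRegular Y := by
  haveI : IsDomain S := isDomain_of_isRegularLocalRing S
  have hqr := isQuasiRegular_regularSystemOfParameters hd x hx
  have hBr : IsRegularRing B := isRegularRing_chart x hx hd i
  haveI := isRegularRing_residue x hx
  haveI := isDomain_residue x hx
  have hxi : x i ≠ 0 := (isRsopPart_comp_of_rsop hd x hx id Function.injective_id).ne_zero i
  have hB : IsDomain B := isDomain_chartRing x i hxi
  have hdu : IsDomain (B ⧸ U) := isDomain_chartRing_quot_span x i hqr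
  have hi0 : (0 : Fin 4) ≠ i := fun h => hi h.symm
  have hc : IsQuasiRegular cc :=
    isQuasiRegular_cons_chartGen x i (fun _ : Fin 1 => (⟨0, hi0⟩ : {j : Fin 4 // j ≠ i})) hqr
      (Function.injective_of_subsingleton _)
  have hrII : IsRegularRing (B ⧸ II) :=
    isRegularRing_quot_cons_chartGen x i (fun _ : Fin 1 => (⟨0, hi0⟩ : {j : Fin 4 // j ≠ i})) hqr
  have he : e[0] ∉ U := chartGen_notMem_span_u x hx hd i 0 hi0
  have hu : uB ∈ nonZeroDivisors B :=
    reesChartBase_mem_nonZeroDivisors (x i) (Ideal.mem_span_range_self (f := x) (x := i))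
  have hu0 : uB ≠ 0 := nonZeroDivisors.ne_zero hu
  have h0 := fun (Y' : Scheme.{u}) (ρ' : Y' ⟶ Spec (.of (chartRing cc 0)))
      (h' : IsBlowup ρ' (affineBlowup.idealSheaf ((J * II ^ m).map (chartBase cc 0)))) =>
    tpPlane_chartPow_zero x i m hc hB hBr hdII hrII hu0 hQr hQ0 h'
  have h1 := fun (Y' : Scheme.{u}) (ρ' : Y' ⟶ Spec (.of (chartRing cc (Fin.succ 0))))
      (h' : IsBlowup ρ' (affineBlowup.idealSheaf ((J * II ^ m).map (chartBase cc (Fin.succ 0))))) =>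
    tpPlane_chartPow_succ x i m hc hB hBr hdII hrII hdu hdy1 hdIIy hdy hry hy hey he heuy hPd hPr hPX h'
  have hcharts : ∀ (k : Fin 2) (Y' : Scheme.{u}) (ρ' : Y' ⟶ Spec (.of (chartRing cc k))),
      IsBlowup ρ' (affineBlowup.idealSheaf ((J * II ^ m).map (chartBase cc k))) → Scheme.IsRegular Y' :=
    Fin.forall_fin_two.mpr ⟨h0, h1⟩
  exact CoreRungTower.isRegular_of_isBlowup_span_singleton_mul (pow_mem hu a) _
    (fun Y' ρ' h' => isRegular_of_isBlowup_mul_of_charts cc (J * II ^ m) hcharts h') hρ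

include hx hd in
/-- **The twisted plane step on `B_i`, `i = 2, 3`, modulo the `s`-chart facts `hQr hQ0`.**
[cite: StacksProject, Tag 080A] [cite: StacksProject, Tag 080B] -/
theorem isRegular_of_isBlowup_tpPlane_corePow_two_three (hi : i ≠ 0) (hi1 : i ≠ 1) (m a : ℕ)
    (hQr : IsRegularRing (PP₀ ⧸ Ideal.span {hFlat})) (hQ0 : hFlat ≠ 0)
    {Y : Scheme.{u}} {ρ : Y ⟶ Spec (.of B)}
    (hρ : IsBlowup ρ (affineBlowup.idealSheaf (Ideal.span {uB ^ a} * ((J * II ^ m) * II)))) :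
    Scheme.IsRegular Y := by
  obtain ⟨hPd, hPr, hPX⟩ := excCurveT_facts x hx hd i hi hi1
  exact isRegular_of_isBlowup_tpPlane_corePow x hx hd i hi m a (isDomain_quot_plane x hx hd i hi)
    (isDomain_quot_span_e1 x hx hd i hi1) (isDomain_quot_plane_sup_e1 x hx hd i hi hi1)
    (isDomain_quot_u_e1 x hx hd i hi1) (isRegularRing_quot_u_e1 x hx hd i hi1)
    (e1_notMem_plane x hx hd i hi hi1) (e0_notMem_span_e1 x hx hd i hi hi1)
    (e0_notMem_u_sup_e1 x hx hd i hi hi1) hPd hPr hPX hQr hQ0 hρ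

include hx hd in
/-- **The twisted plane step on `B₂`, unconditional** (all five exceptional-curve facts from
`…ExcCurveT`, `…ExcCurveS`). [cite: StacksProject, Tag 080A] [cite: StacksProject, Tag 080B] -/
theorem isRegular_of_isBlowup_tpPlane_corePow_two (hi2 : i = 2) (m a : ℕ)
    {Y : Scheme.{u}} {ρ : Y ⟶ Spec (.of B)}
    (hρ : IsBlowup ρ (affineBlowup.idealSheaf (Ideal.span {uB ^ a} * ((J * II ^ m) * II)))) :
    Scheme.IsRegular Y := by
  subst hi2
  exact isRegular_of_isBlowup_tpPlane_corePow_two_three x hx hd 2 (by decide) (by decide) m a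
    (excCurveS_isRegularRing_two x hx hd) (excCurveS_ne_zero_two x hx hd) hρ

end PlanePow

end TwoPlanesRung

end Summit.ResolutionOfSingularities.ResolutionOfSingularities.Theorems

end
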